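import Literature.Barriers.FinalStateConjecture.HairyKerrBifurcation
import Mathlib.MeasureTheory.Integral.IntervalIntegral.AbsolutelyContinuousFun
import Mathlib.Analysis.Calculus.FDeriv.Prod
import Mathlib.Analysis.Calculus.Deriv.Basic
import Mathlib.Topology.Order.IntermediateValue
import HarnessLib

/-!
# Barrier catalogue `FinalStateConjecture`: `HairyKerrBifurcation` — the assembly layer of
# Chodosh–Shlapentokh-Rothman's proof (§13.4 and Appendix, Thm. 15.1), proved
(`Literature/Barriers/FinalStateConjecture/`, D-0021, D-0014, D-0026; family `gr`; namespace
`Literature.Barriers.FinalStateConjecture.HairyKerrBifurcation`)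

`HairyKerrBifurcation.lean` vendors Theorem 1.1 of O. Chodosh, Y. Shlapentokh-Rothman,
*Time-periodic Einstein–Klein–Gordon bifurcations of Kerr*, Comm. Math. Phys. 356 (2017)
1155–1250 (arXiv:1510.08025), as the named fact `HairyKerrBifurcation`. Its printed proof has two
layers:

1. **the PDE construction** (§§3–13, Thm. 13.1, p. 58): for every `0 < |a| < M` a Lipschitz
   one-parameter family `(g_δ, Ψ_δ, μ²(δ))`, `δ ∈ [0, ε)`, of stationary axisymmetric
   Einstein–Klein–Gordon black holes bifurcating off Kerr, with a `δ`-DEPENDENT Klein–Gordon mass —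
   the Carter–Robinson reduction, the linear hair of Shlapentokh-Rothman at the threshold of
   superradiance, and a fixed-point argument in weighted Hölder spaces on a manifold with corners;
   this is a theory (triage XL in the unit notes) and is **not** formalized here;
2. **the assembly** (§13.4, pp. 58–59, with the appendix Thm. 15.1, p. 61): fixing
   `γ² = M² − a²`, the masses `μ²(a, δ)` are Lipschitz in `(a, δ)` (Lemma 13.4.1) and differentiable
   in `δ` at `δ = 0` (Lemma 13.4.2); `a ↦ μ²(a, 0)` is Lipschitz, "and thus absolutely continuous, it
   is differentiable almost everywhere, and the fundamental theorem of calculus holds", so from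
   `lim_{a → 0} μ²(a, 0) = 0` (no superradiance on Schwarzschild) and `μ²(a, 0) > ω² > 0` there is
   "a set of positive measure `𝔇 ⊂ (0, ∞)` so that `a ∈ 𝔇` implies that `d/da μ²(a, 0)` exists and
   is non-zero"; a Lipschitz implicit function theorem (Thm. 15.1, after Halkin) then gives, for
   every `a ∈ 𝔇`, a curve `a(δ)`, `a(0) = a`, differentiable at `0`, along which the mass is
   constant — which is Theorem 1.1 (and Rmk. 1.1: the admissible masses have positive measure).

This file PROVES layer 2 as real analysis (no new named fact is introduced, D-0026):

* `exists_implicitFunction_of_hasFDerivWithinAt` — the implicit function theorem behind Thm. 15.1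
  in neighbourhood form: `f : ℝ × ℝ → ℝ` continuous on `s ×ˢ t` (`s ∈ 𝓝 x₀`, `t ∈ 𝓝[≥] y₀`),
  Fréchet differentiable at `(x₀, y₀)` within `s ×ˢ t`, `f(x₀, y₀) = 0`, `∂ₓ f(x₀, y₀) ≠ 0` ⟹ a
  function `X` on `[y₀, y₀ + η₀)` with `X(y₀) = x₀`, `f(X(y), y) = 0`, and
  `X'(y₀⁺) = −∂_y f / ∂ₓ f (x₀, y₀)`. In one unknown Brouwer's fixed point theorem of the printed
  proof is the intermediate value theorem, and only continuity in `x` and differentiability at the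
  base point are used, so the Lipschitz hypothesis of Thm. 15.1 is weakened to continuity for free;
* `lipschitz_implicitFunction` — **Thm. 15.1 as printed** (`f` Lipschitz on `(−1, 1) × [0, 1)`);
* `volume_pos_deriv_ne_zero` (absolutely continuous `f` on `[a, b]` with `f a ≠ f b`) and
  `volume_pos_deriv_ne_zero_of_lipschitzOnWith` — **the positive-measure set `𝔇`** of §13.4:
  `0 < vol {x ∈ (a, b) | f differentiable at x, f'(x) ≠ 0}` (Mathlib:
  `AbsolutelyContinuousOnInterval.const_of_ae_hasDerivAt_zero`, Lebesgue's differentiation theorem);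
* `volume_pos_setOf_exists_constMassCurve` — **the analytic content of the proof of Thm. 1.1 from
  Thm. 13.1** (§13.4, p. 59): for a mass function `m : ℝ × ℝ → ℝ`, `(a, δ) ↦ μ²(a, δ)`, Lipschitz on
  `(0, A) × [0, ε₀)`, differentiable at `(a₀, 0)` wherever `a ↦ m(a, 0)` is differentiable at `a₀`
  (Lemma 13.4.2 with the uniform `O(δ²)` estimates of its proof), with `m(a, 0) → 0` as `a → 0⁺` and
  `m(a₂, 0) ≠ 0` for some `a₂`, the set of `a₀ ∈ (0, A)` admitting a constant-mass curve
  `δ ↦ a(δ) ∈ (0, A)`, `a(0) = a₀`, differentiable at `0⁺`, on some `[0, η)`, has positive Lebesgue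
  measure.

What remains between this file and `theorem HairyKerrBifurcation_holds` is exactly layer 1
(Thm. 13.1 in its two-parameter form, Lemma 13.4.1), transported to the prelude's Kerr–Schild
exteriors; it is recorded in the unit notes, not vendored (D-0026).

## Mathlib

Used: `HasFDerivWithinAt` and its little-o characterisation, `intermediate_value_Icc`,
`AbsolutelyContinuousOnInterval` (`LipschitzOnWith.absolutelyContinuousOnInterval`,
`.ae_differentiableAt`, `.const_of_ae_hasDerivAt_zero`), `Measure.ae_ne`, `measure_mono`.
Mathlib's implicit function theorems (`Mathlib.Analysis.Calculus.Implicit`) require strict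
differentiability (`HasStrictFDerivAt`) on a neighbourhood and do not cover differentiability at a
single boundary point of a half-plane, which is the situation of Thm. 15.1.

## References

* O. Chodosh, Y. Shlapentokh-Rothman, *Time-periodic Einstein–Klein–Gordon bifurcations of Kerr*,
  Comm. Math. Phys. 356 (2017) 1155–1250, arXiv:1510.08025: §13.4 (Thm. 13.1, Lemmas 13.4.1–13.4.2,
  proof of Thm. 1.1; pp. 58–59) and Appendix "An implicit function theorem for Lipschitz functions"
  (Thm. 15.1, p. 61) (key `ChodoshShlapentokhrothman2017`; numbering of the held arXiv version).
* H. Halkin, *Implicit functions and optimization problems without continuous differentiability of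
  the data*, SIAM J. Control 12 (1974) 229–236 (the source of Thm. 15.1 cited by CSR).
-/

noncomputable section

open Set Filter MeasureTheory Asymptotics Topology
open scoped NNReal

namespace Literature.Barriers.FinalStateConjecture

namespace HairyKerrBifurcation

/-! ### Appendix, Thm. 15.1: an implicit function theorem at a point of differentiability -/

/-- A continuous linear functional on `ℝ × ℝ` is determined by its values on `(1, 0)` and `(0, 1)`:
`φ(u, v) = u φ(1, 0) + v φ(0, 1)`. [folklore] -/
theorem clm_prod_apply (φ : ℝ × ℝ →L[ℝ] ℝ) (u v : ℝ) :
    φ (u, v) = u * φ (1, 0) + v * φ (0, 1) := by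
  have h : ((u, v) : ℝ × ℝ) = u • ((1 : ℝ), (0 : ℝ)) + v • ((0 : ℝ), (1 : ℝ)) := by
    ext <;> simp
  rw [h, map_add, map_smul, map_smul, smul_eq_mul, smul_eq_mul]

/-- **Normalised core of the implicit function theorem of CSR, Thm. 15.1** (one unknown, one-sided
parameter, `∂ₓ g(x₀, y₀) = 1`): if `g` is continuous on `s ×ˢ t` with `s ∈ 𝓝 x₀`, `t ∈ 𝓝[≥] y₀`,
differentiable at `(x₀, y₀)` within `s ×ˢ t` with derivative `g'`, `g(x₀, y₀) = 0` and
`g'(1, 0) = 1`, then there are `η₀ > 0` and `X` with `X(y₀) = x₀`, `X(y) ∈ s` and `g(X(y), y) = 0`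
for `y ∈ [y₀, y₀ + η₀)`, and `X` has right derivative `−g'(0, 1)` at `y₀`. The printed proof
(Brouwer's fixed point theorem for `x ↦ x − g(x, y)` on a small interval) is run with the
intermediate value theorem on `[x₀ − κ(y − y₀), x₀ + κ(y − y₀)]`, `κ = |g'(0, 1)| + 1`, which gives
at once `|X(y) − x₀| ≤ κ (y − y₀)` ("`X` is Lipschitz at `0`") and then the derivative from the
differentiability of `g` at the base point. Chodosh–Shlapentokh-Rothman, CMP 356 (2017), Appendix,
Thm. 15.1 (p. 61 of arXiv:1510.08025), after Halkin, SIAM J. Control 12 (1974).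
[cite: ChodoshShlapentokhrothman2017, Thm. 15.1 (p. 61)] -/
theorem exists_implicitFunction_aux {g : ℝ × ℝ → ℝ} {g' : ℝ × ℝ →L[ℝ] ℝ} {s t : Set ℝ}
    {x₀ y₀ : ℝ} (hs : s ∈ 𝓝 x₀) (ht : t ∈ 𝓝[≥] y₀) (hc : ContinuousOn g (s ×ˢ t))
    (hd : HasFDerivWithinAt g g' (s ×ˢ t) (x₀, y₀)) (h0 : g (x₀, y₀) = 0) (h1 : g' (1, 0) = 1) :
    ∃ η₀ > 0, ∃ X : ℝ → ℝ, X y₀ = x₀ ∧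
      (∀ y ∈ Ico y₀ (y₀ + η₀), X y ∈ s ∧ g (X y, y) = 0) ∧
      HasDerivWithinAt X (-(g' (0, 1))) (Ici y₀) y₀ := by
  obtain ⟨c, hc_def⟩ : ∃ c : ℝ, c = g' (0, 1) := ⟨_, rfl⟩
  obtain ⟨κ, hκ_def⟩ : ∃ κ : ℝ, κ = |c| + 1 := ⟨_, rfl⟩
  have hκ1 : 1 ≤ κ := by rw [hκ_def]; linarith [abs_nonneg c]
  have hκ0 : 0 < κ := lt_of_lt_of_le one_pos hκ1
  have hlin : ∀ u v : ℝ, g' (u, v) = u + v * c := by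
    intro u v
    rw [clm_prod_apply, h1, ← hc_def, mul_one]
  -- the first-order Taylor estimate at the base point, in `δ`-form
  have hest : ∀ ε : ℝ, 0 < ε → ∃ ρ > 0, ∀ q ∈ s ×ˢ t, dist q (x₀, y₀) < ρ →
      |g q - g (x₀, y₀) - g' (q - (x₀, y₀))| ≤ ε * dist q (x₀, y₀) := by
    intro ε hε
    obtain ⟨ρ, hρ, h⟩ := Metric.eventually_nhds_iff.1
      (eventually_nhdsWithin_iff.1 (Asymptotics.isLittleO_iff.1 hd.isLittleO hε))
    refine ⟨ρ, hρ, fun q hq hdist ↦ ?_⟩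
    have h' := h hdist hq
    rwa [Real.norm_eq_abs, ← dist_eq_norm] at h'
  -- neighbourhoods and the basic scale
  obtain ⟨ρs, hρs, hball⟩ := Metric.mem_nhds_iff.1 hs
  obtain ⟨u, hu, hIco⟩ := mem_nhdsGE_iff_exists_Ico_subset.1 ht
  obtain ⟨ρd, hρd, hder⟩ := hest (1 / (2 * κ)) (by positivity)
  obtain ⟨m₀, hm₀_def⟩ : ∃ m₀ : ℝ, m₀ = min (min ρs ρd) (u - y₀) := ⟨_, rfl⟩
  have hu' : y₀ < u := hu
  have hm₀ : 0 < m₀ := by rw [hm₀_def]; exact lt_min (lt_min hρs hρd) (sub_pos.2 hu')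
  have hm₀s : m₀ ≤ ρs := by rw [hm₀_def]; exact (min_le_left _ _).trans (min_le_left _ _)
  have hm₀d : m₀ ≤ ρd := by rw [hm₀_def]; exact (min_le_left _ _).trans (min_le_right _ _)
  have hm₀u : m₀ ≤ u - y₀ := by rw [hm₀_def]; exact min_le_right _ _
  obtain ⟨η₀, hη₀, hη₀κ⟩ : ∃ η₀ : ℝ, 0 < η₀ ∧ 2 * κ * η₀ = m₀ :=
    ⟨m₀ / (2 * κ), by positivity, by field_simp⟩
  -- geometry of the box `|x - x₀| ≤ κ (y - y₀)`, `y₀ ≤ y < y₀ + η₀`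
  have hbox : ∀ y ∈ Ico y₀ (y₀ + η₀), ∀ x : ℝ, |x - x₀| ≤ κ * (y - y₀) →
      (x, y) ∈ s ×ˢ t ∧ dist (x, y) (x₀, y₀) ≤ κ * (y - y₀) ∧ κ * (y - y₀) < m₀ := by
    intro y hy x hx
    have hη : 0 ≤ y - y₀ := sub_nonneg.2 hy.1
    have hηlt : y - y₀ < η₀ := by linarith [hy.2]
    have hr : κ * (y - y₀) < m₀ := by
      have h1 : κ * (y - y₀) < κ * η₀ := mul_lt_mul_of_pos_left hηlt hκ0
      linarith
    have hηr : y - y₀ ≤ κ * (y - y₀) := le_mul_of_one_le_left hη hκ1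
    refine ⟨mk_mem_prod ?_ ?_, ?_, hr⟩
    · apply hball
      rw [Metric.mem_ball, Real.dist_eq]
      linarith
    · exact hIco ⟨hy.1, by linarith⟩
    · rw [Prod.dist_eq, Real.dist_eq, Real.dist_eq, abs_of_nonneg hη]
      exact max_le hx hηr
  -- a zero of `g (·, y)` within `κ (y - y₀)` of `x₀`, for every `y ∈ [y₀, y₀ + η₀)`
  have key : ∀ y ∈ Ico y₀ (y₀ + η₀), ∃ x : ℝ,
      |x - x₀| ≤ κ * (y - y₀) ∧ x ∈ s ∧ g (x, y) = 0 := by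
    intro y hy
    rcases eq_or_lt_of_le hy.1 with h | hlt
    · subst h
      exact ⟨x₀, by simp, mem_of_mem_nhds hs, h0⟩
    have hη : 0 < y - y₀ := sub_pos.2 hlt
    obtain ⟨r, hr_def⟩ : ∃ r : ℝ, r = κ * (y - y₀) := ⟨_, rfl⟩
    have hr0 : 0 < r := by rw [hr_def]; exact mul_pos hκ0 hη
    have hrexp : r = |c| * (y - y₀) + (y - y₀) := by rw [hr_def, hκ_def]; ring
    have hend : ∀ x : ℝ, |x - x₀| ≤ r →
        (x, y) ∈ s ×ˢ t ∧ |g (x, y) - ((x - x₀) + (y - y₀) * c)| ≤ (y - y₀) / 2 := by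
      intro x hx
      rw [hr_def] at hx
      obtain ⟨hmem, hdist, hrm⟩ := hbox y hy x hx
      refine ⟨hmem, ?_⟩
      have h := hder (x, y) hmem (hdist.trans_lt (hrm.trans_le hm₀d))
      rw [h0, sub_zero, Prod.mk_sub_mk, hlin] at h
      calc |g (x, y) - ((x - x₀) + (y - y₀) * c)|
          ≤ 1 / (2 * κ) * dist (x, y) (x₀, y₀) := h
        _ ≤ 1 / (2 * κ) * (κ * (y - y₀)) := by gcongr
        _ = (y - y₀) / 2 := by field_simp
    have hcc : 0 ≤ |c| * (y - y₀) + c * (y - y₀) := by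
      have : 0 ≤ (|c| + c) * (y - y₀) := mul_nonneg (by linarith [neg_abs_le c]) hη.le
      linarith
    have hcc' : 0 ≤ |c| * (y - y₀) - c * (y - y₀) := by
      have : 0 ≤ (|c| - c) * (y - y₀) := mul_nonneg (by linarith [le_abs_self c]) hη.le
      linarith
    obtain ⟨-, hplus⟩ := hend (x₀ + r) (by rw [add_sub_cancel_left, abs_of_pos hr0])
    obtain ⟨-, hminus⟩ := hend (x₀ - r) (by rw [sub_sub_cancel_left, abs_neg, abs_of_pos hr0])
    rw [add_sub_cancel_left] at hplus
    rw [sub_sub_cancel_left] at hminus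
    have hpos : 0 ≤ g (x₀ + r, y) := by
      have h := (abs_le.1 hplus).1
      linarith
    have hneg : g (x₀ - r, y) ≤ 0 := by
      have h := (abs_le.1 hminus).2
      linarith
    have hI : ∀ x ∈ Icc (x₀ - r) (x₀ + r), |x - x₀| ≤ r := fun x hx ↦
      abs_le.2 ⟨by linarith [hx.1], by linarith [hx.2]⟩
    have hGc : ContinuousOn (fun x ↦ g (x, y)) (Icc (x₀ - r) (x₀ + r)) :=
      hc.comp (Continuous.prodMk_left y).continuousOn (fun x hx ↦ (hend x (hI x hx)).1)
    obtain ⟨x, hx, hgx⟩ := intermediate_value_Icc (by linarith) hGc ⟨hneg, hpos⟩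
    exact ⟨x, hr_def ▸ hI x hx, (hend x (hI x hx)).1.1, hgx⟩
  choose! X hX using key
  have hXy₀ : X y₀ = x₀ := by
    have h := (hX y₀ ⟨le_rfl, by linarith⟩).1
    rw [sub_self, mul_zero] at h
    exact sub_eq_zero.1 (abs_nonpos_iff.1 h)
  refine ⟨η₀, hη₀, X, hXy₀, fun y hy ↦ ⟨(hX y hy).2.1, (hX y hy).2.2⟩, ?_⟩
  -- differentiability of `X` at `y₀` from the right
  rw [← hc_def, hasDerivWithinAt_iff_isLittleO, Asymptotics.isLittleO_iff]
  intro ε hε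
  obtain ⟨ρ, hρ, hρest⟩ := hest (ε / κ) (div_pos hε hκ0)
  obtain ⟨θ, hθ, hθη, hθρ⟩ : ∃ θ : ℝ, 0 < θ ∧ θ ≤ η₀ ∧ κ * θ < ρ := by
    refine ⟨min η₀ (ρ / (2 * κ)), lt_min hη₀ (by positivity), min_le_left _ _, ?_⟩
    calc κ * min η₀ (ρ / (2 * κ)) ≤ κ * (ρ / (2 * κ)) := by gcongr; exact min_le_right _ _
      _ = ρ / 2 := by field_simp
      _ < ρ := by linarith
  filter_upwards [Ico_mem_nhdsGE (show y₀ < y₀ + θ by linarith)] with y hy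
  rcases eq_or_lt_of_le hy.1 with h | hlt
  · subst h
    simp
  have hyI : y ∈ Ico y₀ (y₀ + η₀) := ⟨hy.1, by linarith [hy.2]⟩
  obtain ⟨hxb, -, hx0⟩ := hX y hyI
  obtain ⟨hmem, hdist, -⟩ := hbox y hyI (X y) hxb
  have hyρ : dist (X y, y) (x₀, y₀) < ρ := by
    refine hdist.trans_lt ?_
    calc κ * (y - y₀) < κ * θ := mul_lt_mul_of_pos_left (by linarith [hy.2]) hκ0
      _ < ρ := hθρ
  have h := hρest (X y, y) hmem hyρ
  rw [h0, hx0, Prod.mk_sub_mk, hlin, sub_zero, zero_sub, abs_neg] at h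
  rw [hXy₀, smul_eq_mul, Real.norm_eq_abs, Real.norm_eq_abs, abs_of_pos (sub_pos.2 hlt)]
  calc |X y - x₀ - (y - y₀) * -c| = |(X y - x₀) + (y - y₀) * c| := by
        congr 1; ring
    _ ≤ ε / κ * dist (X y, y) (x₀, y₀) := h
    _ ≤ ε / κ * (κ * (y - y₀)) := by gcongr
    _ = ε * (y - y₀) := by field_simp

/-- **The implicit function theorem behind CSR's Thm. 15.1, neighbourhood form.** Let
`f : ℝ × ℝ → ℝ` be continuous on `s ×ˢ t`, where `s` is a neighbourhood of `x₀` and `t` a right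
neighbourhood of `y₀` (`t ∈ 𝓝[≥] y₀`, e.g. `t = [y₀, y₀ + 1)`), Fréchet differentiable at
`(x₀, y₀)` within `s ×ˢ t` with derivative `f'`, with `f(x₀, y₀) = 0` and `∂ₓ f(x₀, y₀) = f'(1, 0) ≠ 0`.
Then for some `η₀ > 0` there is `X : [y₀, y₀ + η₀) → s` (a function `ℝ → ℝ` in code) with
`X(y₀) = x₀`, `f(X(y), y) = 0` on `[y₀, y₀ + η₀)`, differentiable at `y₀` from the right with
`X'(y₀) = −f'(0, 1) / f'(1, 0)`. Thm. 15.1 assumes `f` Lipschitz; its proof uses only continuity in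
`x` (for Brouwer = the intermediate value theorem in one unknown) and differentiability at the base
point, so the statement is proved in this generality. Chodosh–Shlapentokh-Rothman, CMP 356 (2017),
Appendix, Thm. 15.1 (p. 61), after H. Halkin, SIAM J. Control 12 (1974) 229–236.
[cite: ChodoshShlapentokhrothman2017, Thm. 15.1 (p. 61)] -/
theorem exists_implicitFunction_of_hasFDerivWithinAt {f : ℝ × ℝ → ℝ} {f' : ℝ × ℝ →L[ℝ] ℝ}
    {s t : Set ℝ} {x₀ y₀ : ℝ} (hs : s ∈ 𝓝 x₀) (ht : t ∈ 𝓝[≥] y₀) (hc : ContinuousOn f (s ×ˢ t))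
    (hd : HasFDerivWithinAt f f' (s ×ˢ t) (x₀, y₀)) (h0 : f (x₀, y₀) = 0) (hL : f' (1, 0) ≠ 0) :
    ∃ η₀ > 0, ∃ X : ℝ → ℝ, X y₀ = x₀ ∧
      (∀ y ∈ Ico y₀ (y₀ + η₀), X y ∈ s ∧ f (X y, y) = 0) ∧
      HasDerivWithinAt X (-(f' (0, 1) / f' (1, 0))) (Ici y₀) y₀ := by
  obtain ⟨L, hL_def⟩ : ∃ L : ℝ, L = f' (1, 0) := ⟨_, rfl⟩
  rw [← hL_def] at hL ⊢
  have hcg : ContinuousOn (fun q ↦ L⁻¹ * f q) (s ×ˢ t) := continuousOn_const.mul hc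
  have hdg : HasFDerivWithinAt (fun q ↦ L⁻¹ * f q) (L⁻¹ • f') (s ×ˢ t) (x₀, y₀) :=
    hd.const_mul L⁻¹
  have h0g : L⁻¹ * f (x₀, y₀) = 0 := by rw [h0, mul_zero]
  have h1g : (L⁻¹ • f') (1, 0) = 1 := by
    change L⁻¹ * f' (1, 0) = 1
    rw [← hL_def, inv_mul_cancel₀ hL]
  obtain ⟨η₀, hη₀, X, hX0, hX, hXd⟩ := exists_implicitFunction_aux hs ht hcg hdg h0g h1g
  refine ⟨η₀, hη₀, X, hX0, fun y hy ↦ ⟨(hX y hy).1, ?_⟩, ?_⟩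
  · rcases mul_eq_zero.1 (hX y hy).2 with h | h
    · exact absurd h (inv_ne_zero hL)
    · exact h
  · convert hXd using 1
    change -(f' (0, 1) / L) = -(L⁻¹ * f' (0, 1))
    rw [inv_mul_eq_div]

/-- **CSR Thm. 15.1 as printed (an implicit function theorem for Lipschitz functions, after
Halkin).** "Suppose that `f(x, y) : {(x, y) : x ∈ (−1, 1), y ∈ [0, 1)} → ℝ` is Lipschitz and
differentiable at `(0, 0)` with `f(0, 0) = 0` and `∂ₓ f(0, 0) ≠ 0`. Then, for some `η₀ > 0`, there
is a function `X : [0, η₀) → (−1, 1)`, so that `X(0) = 0`, `f(X(y), y) = 0` for `y ∈ [0, η₀)`, and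
so that `X` is differentiable at `0`." Differentiability at the corner point `(0, 0)` of the domain
is Fréchet differentiability within the domain (`HasFDerivWithinAt`), and differentiability of `X`
at the endpoint `0` of `[0, η₀)` is one-sided (`DifferentiableWithinAt … (Ici 0) 0`).
Chodosh–Shlapentokh-Rothman, CMP 356 (2017), Appendix, Thm. 15.1 (p. 61 of arXiv:1510.08025); H.
Halkin, SIAM J. Control 12 (1974) 229–236. [cite: ChodoshShlapentokhrothman2017, Thm. 15.1 (p. 61)] -/
theorem lipschitz_implicitFunction {f : ℝ × ℝ → ℝ} {K : ℝ≥0} {f' : ℝ × ℝ →L[ℝ] ℝ}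
    (hf : LipschitzOnWith K f (Ioo (-1) 1 ×ˢ Ico 0 1))
    (hd : HasFDerivWithinAt f f' (Ioo (-1) 1 ×ˢ Ico 0 1) (0, 0)) (h0 : f (0, 0) = 0)
    (hx : f' (1, 0) ≠ 0) :
    ∃ η₀ > 0, ∃ X : ℝ → ℝ, X 0 = 0 ∧ (∀ y ∈ Ico 0 η₀, X y ∈ Ioo (-1) 1 ∧ f (X y, y) = 0) ∧
      DifferentiableWithinAt ℝ X (Ici 0) 0 := by
  have hs : Ioo (-1 : ℝ) 1 ∈ 𝓝 (0 : ℝ) := Ioo_mem_nhds (by norm_num) (by norm_num)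
  have ht : Ico (0 : ℝ) 1 ∈ 𝓝[≥] (0 : ℝ) := Ico_mem_nhdsGE (by norm_num)
  obtain ⟨η₀, hη₀, X, hX0, hX, hXd⟩ :=
    exists_implicitFunction_of_hasFDerivWithinAt hs ht hf.continuousOn hd h0 hx
  refine ⟨η₀, hη₀, X, hX0, fun y hy ↦ hX y ?_, hXd.differentiableWithinAt⟩
  rwa [zero_add]

/-! ### §13.4: the positive-measure set of parameters with non-zero mass derivative -/

/-- **The set `𝔇` of §13.4 has positive measure (absolutely continuous form).** If `f : ℝ → ℝ` is
absolutely continuous on `[a, b]`, `a < b`, and `f a ≠ f b`, then the set of `x ∈ (a, b)` at which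
`f` is differentiable with `f'(x) ≠ 0` has positive Lebesgue measure: otherwise `f' = 0` a.e. (an
absolutely continuous function "is differentiable almost everywhere, and the fundamental theorem of
calculus holds"), so `f` would be constant on `[a, b]`. Chodosh–Shlapentokh-Rothman, CMP 356 (2017),
§13.4, proof of Thm. 1.1 (p. 59 of arXiv:1510.08025): "we can find a set of positive measure
`𝔇 ⊂ (0, ∞)` so that `a ∈ 𝔇` implies that `d/da (μ²(a, M(a), 0))` exists and is non-zero".
[cite: ChodoshShlapentokhrothman2017, §13.4 (p. 59)] -/
theorem volume_pos_deriv_ne_zero {f : ℝ → ℝ} {a b : ℝ} (hab : a < b)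
    (hf : AbsolutelyContinuousOnInterval f a b) (hne : f a ≠ f b) :
    0 < volume {x ∈ Ioo a b | DifferentiableAt ℝ f x ∧ deriv f x ≠ 0} := by
  rw [pos_iff_ne_zero]
  intro hD
  have h1 : ∀ᵐ x, x ∉ {x ∈ Ioo a b | DifferentiableAt ℝ f x ∧ deriv f x ≠ 0} :=
    measure_eq_zero_iff_ae_notMem.1 hD
  have h2 := hf.ae_differentiableAt
  have h3 : ∀ᵐ x, x ∈ uIcc a b → HasDerivAt f 0 x := by
    filter_upwards [h1, h2, Measure.ae_ne volume a, Measure.ae_ne volume b]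
      with x hx1 hx2 hxa hxb hx
    have hx' : x ∈ Ioo a b := by
      rw [uIcc_of_le hab.le] at hx
      exact ⟨lt_of_le_of_ne hx.1 (Ne.symm hxa), lt_of_le_of_ne hx.2 hxb⟩
    have hd := hx2 hx
    have hzero : deriv f x = 0 := by
      by_contra h
      exact hx1 ⟨hx', hd, h⟩
    exact hzero ▸ hd.hasDerivAt
  obtain ⟨C, hC⟩ := hf.const_of_ae_hasDerivAt_zero h3
  exact hne ((hC a left_mem_uIcc).trans (hC b right_mem_uIcc).symm)

/-- **The set `𝔇` of §13.4 has positive measure (Lipschitz form, as used by CSR).** A Lipschitz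
function on `[a, b]` is absolutely continuous, so `volume_pos_deriv_ne_zero` applies: if
`f a ≠ f b` then `{x ∈ (a, b) | f differentiable at x, f'(x) ≠ 0}` has positive measure — "Because
`a ↦ μ²(a, M(a), 0)` is Lipchitz, and thus absolutely continuous, it is differentiable almost
everywhere, and the fundamental theorem of calculus holds." Chodosh–Shlapentokh-Rothman, CMP 356
(2017), §13.4 (p. 59). [cite: ChodoshShlapentokhrothman2017, §13.4 (p. 59)] -/
theorem volume_pos_deriv_ne_zero_of_lipschitzOnWith {f : ℝ → ℝ} {a b : ℝ} {K : ℝ≥0} (hab : a < b)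
    (hf : LipschitzOnWith K f (Icc a b)) (hne : f a ≠ f b) :
    0 < volume {x ∈ Ioo a b | DifferentiableAt ℝ f x ∧ deriv f x ≠ 0} := by
  refine volume_pos_deriv_ne_zero hab ?_ hne
  rw [← uIcc_of_le hab.le] at hf
  exact hf.absolutelyContinuousOnInterval

/-! ### §13.4: arranging for a constant Klein–Gordon mass -/

/-- **The analytic content of the proof of CSR Thm. 1.1 from Thm. 13.1 (§13.4, "Arranging for a
constant Klein–Gordon mass").** Let `m : ℝ × ℝ → ℝ` — in CSR, `m(a, δ) = μ²(a, M(a), δ)`, the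
Klein–Gordon mass of the solution of Thm. 13.1 with Kerr parameter `a` (at fixed `γ² = M² − a²`) and
bifurcation parameter `δ` — satisfy: `m` is Lipschitz on `(0, A) × [0, ε₀)` (Lemma 13.4.1); `m` is
differentiable at `(a₀, 0)` within this set whenever `a ↦ m(a, 0)` is differentiable at `a₀`
(Lemma 13.4.2: the unknowns are `O(δ²)`, differentiable in `δ` at `δ = 0` with vanishing
derivative); `m(a, 0) → 0` as `a → 0⁺` ("no superradiance on Schwarzschild"); and `m(a₂, 0) ≠ 0`
for some `a₂ ∈ (0, A)` (in CSR `m(a, 0) > ω² > 0` for all `a`). Then the set of `a₀ ∈ (0, A)` for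
which there are `η > 0` and a curve `a : [0, η) → (0, A)` (a function `ℝ → ℝ` in code) with
`a(0) = a₀`, differentiable at `0` from the right, and `m(a(δ), δ) = m(a₀, 0)` for all
`δ ∈ [0, η)` — a constant-mass reparametrisation — has positive Lebesgue measure: it contains the
positive-measure set `𝔇` where `d/da m(a, 0)` exists and is non-zero
(`volume_pos_deriv_ne_zero_of_lipschitzOnWith`), by the implicit function theorem
`exists_implicitFunction_of_hasFDerivWithinAt` applied to `f(x, y) = m(x, y) − m(a₀, 0)`. "Using
this choice of `a(δ)` in the previously constructed solutions from Theorem 13.1 yields a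
`1`-parameter family of metrics with the properties asserted in Theorem 1.1."
Chodosh–Shlapentokh-Rothman, CMP 356 (2017), §13.4, proof of Thm. 1.1 (p. 59 of arXiv:1510.08025),
with Lemmas 13.4.1–13.4.2 (the positive measure of the set of resulting MASSES, Rmk. 1.1, is not
asserted here). [cite: ChodoshShlapentokhrothman2017, §13.4 (p. 59)] -/
theorem volume_pos_setOf_exists_constMassCurve {m : ℝ × ℝ → ℝ} {A ε₀ : ℝ} {K : ℝ≥0}
    (hε₀ : 0 < ε₀) (hK : LipschitzOnWith K m (Ioo 0 A ×ˢ Ico 0 ε₀))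
    (hdiff : ∀ a₀ ∈ Ioo 0 A, DifferentiableAt ℝ (fun a ↦ m (a, 0)) a₀ →
      DifferentiableWithinAt ℝ m (Ioo 0 A ×ˢ Ico 0 ε₀) (a₀, 0))
    (hlim : Tendsto (fun a ↦ m (a, 0)) (𝓝[>] 0) (𝓝 0)) (hne : ∃ a₂ ∈ Ioo 0 A, m (a₂, 0) ≠ 0) :
    0 < volume {a₀ ∈ Ioo 0 A | ∃ η > 0, ∃ X : ℝ → ℝ, X 0 = a₀ ∧
      DifferentiableWithinAt ℝ X (Ici 0) 0 ∧
      ∀ δ ∈ Ico 0 η, (X δ, δ) ∈ Ioo 0 A ×ˢ Ico 0 ε₀ ∧ m (X δ, δ) = m (a₀, 0)} := by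
  obtain ⟨a₂, ha₂, hm₂⟩ := hne
  -- a point `a₁ ∈ (0, a₂)` with a different mass, from `m(a, 0) → 0`
  obtain ⟨a₁, ha₁, hm₁⟩ : ∃ a₁ ∈ Ioo 0 a₂, m (a₁, 0) ≠ m (a₂, 0) := by
    have h1 : ∀ᶠ a in 𝓝[>] (0 : ℝ), m (a, 0) ∈ Metric.ball (0 : ℝ) |m (a₂, 0)| :=
      hlim.eventually_mem (Metric.ball_mem_nhds 0 (abs_pos.2 hm₂))
    have h2 : ∀ᶠ a in 𝓝[>] (0 : ℝ), a ∈ Ioo 0 a₂ := Ioo_mem_nhdsGT ha₂.1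
    obtain ⟨a₁, h1', h2'⟩ := (h1.and h2).exists
    refine ⟨a₁, h2', fun h ↦ ?_⟩
    rw [Metric.mem_ball, dist_zero_right, Real.norm_eq_abs, h] at h1'
    exact lt_irrefl _ h1'
  have hA₂ : a₂ < A := ha₂.2
  have hmem : ∀ x ∈ Icc a₁ a₂, (x, (0 : ℝ)) ∈ Ioo 0 A ×ˢ Ico 0 ε₀ := fun x hx ↦
    mk_mem_prod ⟨ha₁.1.trans_le hx.1, hx.2.trans_lt hA₂⟩ ⟨le_rfl, hε₀⟩
  -- `a ↦ m(a, 0)` is Lipschitz on `[a₁, a₂]`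
  have hf : LipschitzOnWith K (fun a ↦ m (a, 0)) (Icc a₁ a₂) := by
    intro x hx y hy
    calc edist (m (x, 0)) (m (y, 0)) ≤ K * edist (x, (0 : ℝ)) (y, (0 : ℝ)) :=
          hK (hmem x hx) (hmem y hy)
      _ = K * edist x y := by simp [Prod.edist_eq]
  -- the positive-measure set `𝔇`
  have hD := volume_pos_deriv_ne_zero_of_lipschitzOnWith (f := fun a ↦ m (a, 0)) ha₁.2 hf hm₁
  refine hD.trans_le (measure_mono ?_)
  rintro a₀ ⟨ha₀, hDiff, hLne⟩
  have ha₀' : a₀ ∈ Ioo 0 A := ⟨ha₁.1.trans ha₀.1, ha₀.2.trans hA₂⟩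
  -- the derivative of `m` at `(a₀, 0)` and its `x`-component
  have hfa : HasDerivAt (fun a ↦ m (a, 0)) (deriv (fun a ↦ m (a, 0)) a₀) a₀ := hDiff.hasDerivAt
  have hmd : DifferentiableWithinAt ℝ m (Ioo 0 A ×ˢ Ico 0 ε₀) (a₀, 0) := hdiff a₀ ha₀' hDiff
  obtain ⟨φ, hφ⟩ : ∃ φ : ℝ × ℝ →L[ℝ] ℝ, HasFDerivWithinAt m φ (Ioo 0 A ×ˢ Ico 0 ε₀) (a₀, 0) :=
    ⟨_, hmd.hasFDerivWithinAt⟩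
  have hcomp : HasFDerivWithinAt (m ∘ fun a : ℝ ↦ (a, (0 : ℝ)))
      (φ.comp (ContinuousLinearMap.inl ℝ ℝ ℝ)) (Ioo 0 A) a₀ :=
    hφ.comp a₀ (hasFDerivAt_prodMk_left a₀ (0 : ℝ)).hasFDerivWithinAt
      (fun a ha ↦ mk_mem_prod ha (show (0 : ℝ) ∈ Ico 0 ε₀ from ⟨le_rfl, hε₀⟩))
  have hderiv : HasDerivAt (fun a ↦ m (a, 0)) (φ (1, 0)) a₀ := by
    have h := (hcomp.hasFDerivAt (Ioo_mem_nhds ha₀'.1 ha₀'.2)).hasDerivAt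
    simpa [Function.comp_def] using h
  have hL : φ (1, 0) = deriv (fun a ↦ m (a, 0)) a₀ := hderiv.unique hfa
  have hL' : φ (1, 0) ≠ 0 := by rw [hL]; exact hLne
  -- the implicit function theorem for `f (x, y) = m (x, y) - m (a₀, 0)` at `(a₀, 0)`
  obtain ⟨η₀, hη₀, X, hX0, hX, hXd⟩ := exists_implicitFunction_of_hasFDerivWithinAt
    (f := fun q ↦ m q - m (a₀, 0)) (Ioo_mem_nhds ha₀'.1 ha₀'.2) (Ico_mem_nhdsGE hε₀)
    (hK.continuousOn.sub continuousOn_const) (hφ.sub_const (m (a₀, 0))) (sub_self _) hL'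
  refine ⟨ha₀', min η₀ ε₀, lt_min hη₀ hε₀, X, hX0, hXd.differentiableWithinAt, fun δ hδ ↦ ?_⟩
  have hδ₀ : δ ∈ Ico 0 (0 + η₀) := by
    rw [zero_add]
    exact ⟨hδ.1, hδ.2.trans_le (min_le_left _ _)⟩
  have hδε : δ ∈ Ico 0 ε₀ := ⟨hδ.1, hδ.2.trans_le (min_le_right _ _)⟩
  obtain ⟨hXs, hXm⟩ := hX δ hδ₀
  exact ⟨mk_mem_prod hXs hδε, sub_eq_zero.1 hXm⟩

end HairyKerrBifurcation

end Literature.Barriers.FinalStateConjecture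

end
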